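import Literature.Computability.AlgebraicComplexity.DIP20PlethysmValues
import HarnessLib

/-!
# The counting formula (4.4) for FOUR rows, expanded over `S_4` (tools for four-letter plethysm values)

Topic `Literature/Computability/AlgebraicComplexity`; continuation of `DIP20PlethysmValuesRow3.lean`
(`plethysmCoeff_fin_three_cast_eq_six_counts`, the three-row expansion). No new facts, no definitions.
Dörfler–Ikenmeyer–Panova 2020 (arXiv:1901.04576), eq. (4.4) (arXiv p. 9), tree `DIP20_eq_4_4_holds`:
`a_λ(d[n]) = Σ_{π ∈ S_ℓ} sgn(π) c_{λ+π-id}(d,n)`. For `ℓ = 4` (the four-row statements of the paper: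
Lemma 3.13, Prop. 3.14, Prop. 3.15 row 5, Thm. 2.3 (2)(b)) this file provides

* `plethysmCoeff_fin_four_cast_eq_sum_dipMonomialCountL`: (4.4) with the kernel counter
  `dipMonomialCountL` of `DIP20MonomialCounts.lean` (four rows);
* `dipMonomialCount_succ_d_four` / `dipMonomialCount_succ_n_four`: stability of the four-row tail counts
  (adding `(n,0,0,0)` once `d ≥ y+z+w`; raising first coordinates once `n ≥ y+z+w`), the four-row twins
  of the lemmas of `DIP20Lemma37Tail33.lean` — the reduction step for Lemma 3.13's remaining bodies;
* `plethysmCoeff_fin_four_cast_eq_twentyfour_counts`: the sum over `S_4` EXPANDED into the `24`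
  evaluations of `countVecMultisetsL (weakCompsL 4 n) d [·,·,·,·]` on literal coordinate lists (terms with
  a negative coordinate omitted), so that each count can be its own `decide +kernel` (cf. the three-row
  file: the kernel must never re-reduce a permutation inside the counting recursion).

HONEST FRAMING: bookkeeping for toy-model plethysm arithmetic; VP ≠ VNP is not proved.

## References

* [DorflerIkenmeyerPanova2020] eq. (4.3)–(4.4) (arXiv p. 9).
-/

open scoped BigOperators

namespace Literature.Computability.AlgebraicComplexity

open _root_.Literature.NumberTheory.DiophantineGeometry

/-- A weakly decreasing `4`-vector is antitone. [folklore] -/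
private theorem antitone_fin4 {μ : Fin 4 → ℕ} (h10 : μ 1 ≤ μ 0) (h21 : μ 2 ≤ μ 1) (h32 : μ 3 ≤ μ 2) :
    Antitone μ := by
  intro i j hij
  fin_cases i <;> fin_cases j <;> simp at hij ⊢ <;> omega

/-- **(4.4) in evaluable form for four rows**: for a `4`-partition `μ` of `dn` (`n ≥ 1`),
`a_μ(d[n]) = Σ_{π ∈ S_4} sgn(π) c_{μ+π-id}(d,n)` with each `c_ν(d,n)` the list evaluator `dipMonomialCountL`.
[cite: DorflerIkenmeyerPanova2020, eqs. (4.3)–(4.4) (arXiv p. 9)] -/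
theorem plethysmCoeff_fin_four_cast_eq_sum_dipMonomialCountL (μ : Fin 4 → ℕ) {n d : ℕ} (hn : 0 < n)
    (h10 : μ 1 ≤ μ 0) (h21 : μ 2 ≤ μ 1) (h32 : μ 3 ≤ μ 2) (hsum : ∑ i, μ i = d * n) :
    (plethysmCoeff ℂ (Fin 4) n (rowDual μ) : ℤ) =
      ∑ π : Equiv.Perm (Fin 4), ((Equiv.Perm.sign π : ℤˣ) : ℤ) *
        (if ∀ i : Fin 4, (i : ℕ) ≤ μ i + (π i : ℕ)
          then (dipMonomialCountL (fun i : Fin 4 => μ i + (π i : ℕ) - (i : ℕ)) d n : ℤ) else 0) := by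
  have h := DIP20_eq_4_4_holds 4 n d μ hn (antitone_fin4 h10 h21 h32) hsum
  simpa only [dipMonomialCount_eq_L] using h

/-- The six permutations of `Fin 3` (local copy of the three-row file's enumeration). [folklore] -/
private theorem univ_perm_fin_three'' : (Finset.univ : Finset (Equiv.Perm (Fin 3))) =
    {1, Equiv.swap 0 1, Equiv.swap 1 2, Equiv.swap 0 2, Equiv.swap 0 1 * Equiv.swap 1 2,
      Equiv.swap 1 2 * Equiv.swap 0 1} := by
  decide

/-- **(4.4) for a `4`-partition `(a,b,c,e)`, the sum over `S_4` EXPANDED** into `24` evaluations of the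
list counter on literal coordinate lists (`C(w,x,y,z) = countVecMultisetsL (weakCompsL 4 n) d [w,x,y,z]`;
terms with a negative coordinate omitted; the right-hand side is stated in the `simp`-normal nested form,
signed by `sgn(π)`, so that instances close by rewriting).
[cite: DorflerIkenmeyerPanova2020, eqs. (4.3)–(4.4) (arXiv p. 9)] -/
theorem plethysmCoeff_fin_four_cast_eq_twentyfour_counts (a b c e : ℕ) {n d : ℕ} (hn : 0 < n)
    (h10 : b ≤ a) (h21 : c ≤ b) (h32 : e ≤ c) (hsum : a + b + c + e = d * n) :
    (plethysmCoeff ℂ (Fin 4) n (rowDual ![a, b, c, e]) : ℤ) =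
      ↑(countVecMultisetsL (weakCompsL 4 n) d [a, b, c, e]) +
      ((if 1 ≤ c then -↑(countVecMultisetsL (weakCompsL 4 n) d [a, b + 1, c - 1, e]) else 0) +
      ((if 1 ≤ e then -↑(countVecMultisetsL (weakCompsL 4 n) d [a, b, c + 1, e - 1]) else 0) +
      ((if 2 ≤ e then -↑(countVecMultisetsL (weakCompsL 4 n) d [a, b + 2, c, e - 2]) else 0) +
      ((if 2 ≤ e then ↑(countVecMultisetsL (weakCompsL 4 n) d [a, b + 1, c + 1, e - 2]) else 0) +
      if 1 ≤ c ∧ 1 ≤ e then ↑(countVecMultisetsL (weakCompsL 4 n) d [a, b + 2, c - 1, e - 1]) else 0)))) +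
      ((if 1 ≤ b then -↑(countVecMultisetsL (weakCompsL 4 n) d [a + 1, b - 1, c, e]) else 0) +
      ((if 2 ≤ c then ↑(countVecMultisetsL (weakCompsL 4 n) d [a + 1, b + 1, c - 2, e]) else 0) +
      ((if 1 ≤ b ∧ 1 ≤ e then ↑(countVecMultisetsL (weakCompsL 4 n) d [a + 1, b - 1, c + 1, e - 1]) else 0) +
      ((if 3 ≤ e then ↑(countVecMultisetsL (weakCompsL 4 n) d [a + 1, b + 2, c, e - 3]) else 0) +
      ((if 3 ≤ e then -↑(countVecMultisetsL (weakCompsL 4 n) d [a + 1, b + 1, c + 1, e - 3]) else 0) +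
      if 2 ≤ c ∧ 1 ≤ e then -↑(countVecMultisetsL (weakCompsL 4 n) d [a + 1, b + 2, c - 2, e - 1])
      else 0))))) +
      ((if 2 ≤ c then -↑(countVecMultisetsL (weakCompsL 4 n) d [a + 2, b, c - 2, e]) else 0) +
      ((if 1 ≤ b ∧ 1 ≤ c then ↑(countVecMultisetsL (weakCompsL 4 n) d [a + 2, b - 1, c - 1, e]) else 0) +
      ((if 3 ≤ e then ↑(countVecMultisetsL (weakCompsL 4 n) d [a + 2, b, c + 1, e - 3]) else 0) +
      ((if 2 ≤ c ∧ 2 ≤ e then ↑(countVecMultisetsL (weakCompsL 4 n) d [a + 2, b + 2, c - 2, e - 2]) else 0) +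
      ((if 1 ≤ b ∧ 2 ≤ e then -↑(countVecMultisetsL (weakCompsL 4 n) d [a + 2, b - 1, c + 1, e - 2]) else 0) +
      if 1 ≤ c ∧ 3 ≤ e then -↑(countVecMultisetsL (weakCompsL 4 n) d [a + 2, b + 2, c - 1, e - 3])
      else 0))))) +
      ((if 3 ≤ e then -↑(countVecMultisetsL (weakCompsL 4 n) d [a + 3, b, c, e - 3]) else 0) +
      ((if 1 ≤ c ∧ 3 ≤ e then ↑(countVecMultisetsL (weakCompsL 4 n) d [a + 3, b + 1, c - 1, e - 3]) else 0) +
      ((if 2 ≤ c ∧ 1 ≤ e then ↑(countVecMultisetsL (weakCompsL 4 n) d [a + 3, b, c - 2, e - 1]) else 0) +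
      ((if 1 ≤ b ∧ 2 ≤ e then ↑(countVecMultisetsL (weakCompsL 4 n) d [a + 3, b - 1, c, e - 2]) else 0) +
      ((if 2 ≤ c ∧ 2 ≤ e then -↑(countVecMultisetsL (weakCompsL 4 n) d [a + 3, b + 1, c - 2, e - 2]) else 0) +
      if 1 ≤ b ∧ 1 ≤ c ∧ 1 ≤ e then -↑(countVecMultisetsL (weakCompsL 4 n) d [a + 3, b - 1, c - 1, e - 1])
      else 0))))) := by
  rw [plethysmCoeff_fin_four_cast_eq_sum_dipMonomialCountL ![a, b, c, e] hn (by simpa using h10)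
    (by simpa using h21) (by simpa using h32) (by rw [Fin.sum_univ_four]; exact hsum),
    ← Equiv.sum_comp (Equiv.Perm.decomposeFin (n := 3)).symm, Fintype.sum_prod_type, Fin.sum_univ_four,
    univ_perm_fin_three'']
  repeat rw [Finset.sum_insert (by decide)]
  simp only [Finset.sum_singleton]
  simp +decide only [dipMonomialCountL, Fin.forall_fin_succ, IsEmpty.forall_iff, and_true, List.ofFn_succ,
    List.ofFn_zero, Equiv.Perm.decomposeFin.symm_sign, Equiv.Perm.decomposeFin_symm_apply_zero,
    Equiv.Perm.decomposeFin_symm_apply_succ, Equiv.Perm.sign_one, Equiv.Perm.sign_mul,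
    Equiv.Perm.sign_swap', Equiv.Perm.one_apply, Equiv.Perm.mul_apply, Equiv.swap_apply_def,
    Matrix.cons_val_zero, Matrix.cons_val_succ, Fin.isValue, Fin.val_zero, Fin.val_one, Fin.val_two,
    Fin.val_succ, Fin.succ_zero_eq_one, Fin.succ_one_eq_two]
  norm_num
  have g1 : (2 ≤ c + 1) ↔ (1 ≤ c) := by omega
  have g2 : c + 1 - 2 = c - 1 := by omega
  have g3 : (3 ≤ e + 1) ↔ (2 ≤ e) := by omega
  have g4 : e + 1 - 3 = e - 2 := by omega
  have g5 : (3 ≤ e + 2) ↔ (1 ≤ e) := by omega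
  have g6 : e + 2 - 3 = e - 1 := by omega
  have g9 : c + 3 - 2 = c + 1 := by omega
  simp only [g1, g2, g3, g4, g5, g6, g9]

/-! ### Stability of the four-row tail counts `c_{(x,y,z,w)}(d,n)` (tools for Lemma 3.13) -/

section Stabilisation4

/-- Coordinates of a multiset sum of vectors. [folklore] -/
private theorem msum_apply4 {ℓ : ℕ} (M : Multiset (Fin ℓ → ℕ)) (i : Fin ℓ) :
    M.sum i = (M.map fun α => α i).sum := by
  induction M using Multiset.induction_on with
  | empty => simp
  | cons a M ih => simp [ih]

/-- A member of a multiset of vectors is bounded, coordinatewise, by the sum. [folklore] -/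
private theorem apply_le_sum_apply4 {ℓ : ℕ} {M : Multiset (Fin ℓ → ℕ)} {α : Fin ℓ → ℕ} (hα : α ∈ M)
    (i : Fin ℓ) : α i ≤ M.sum i := by
  rw [msum_apply4]
  have h : α i ∈ M.map (fun β => β i) := Multiset.mem_map_of_mem (fun β => β i) hα
  exact Multiset.le_sum_of_mem h

/-- The number of members with nonzero tail is at most the total tail `Σ (α 1 + α 2 + α 3)`. [folklore] -/
private theorem card_filter_tail4_le (M : Multiset (Fin 4 → ℕ)) :
    Multiset.card (M.filter fun α => α 1 + α 2 + α 3 ≠ 0) ≤ M.sum 1 + M.sum 2 + M.sum 3 := by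
  induction M using Multiset.induction_on with
  | empty => simp
  | cons a M ih =>
    rw [Multiset.filter_cons, Multiset.card_add, Multiset.sum_cons, Pi.add_apply, Pi.add_apply,
      Pi.add_apply]
    split_ifs with h
    · simp only [Multiset.card_singleton]
      omega
    · simp only [Multiset.card_zero, zero_add]
      omega

/-- A weak `4`-composition of `n` with zero tail is `(n, 0, 0, 0)`. [folklore] -/
private theorem eq_head4_of_tail_eq_zero {n : ℕ} {α : Fin 4 → ℕ} (hsum : ∑ i, α i = n)
    (h : α 1 + α 2 + α 3 = 0) : α = ![n, 0, 0, 0] := by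
  rw [Fin.sum_univ_four] at hsum
  funext i
  fin_cases i
  · simp; omega
  · simp; omega
  · simp; omega
  · simp; omega

/-- **`d`-stabilisation, four rows**: for `y + z + w ≤ d` (`ν = (x,y,z,w)`), adding one copy of
`(n,0,0,0)` is a bijection from the multisets counted by `c_ν(d,n)` onto those counted by
`c_{ν+(n,0,0,0)}(d+1,n)`. [cite: DorflerIkenmeyerPanova2020, eq. (4.3) (arXiv p. 9)] -/
theorem dipMonomialCount_succ_d_four (n d : ℕ) (ν : Fin 4 → ℕ) (hν : ν 1 + ν 2 + ν 3 ≤ d) :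
    dipMonomialCount (ν + ![n, 0, 0, 0]) (d + 1) n = dipMonomialCount ν d n := by
  classical
  set e : Fin 4 → ℕ := ![n, 0, 0, 0] with he
  have hesum : ∑ i, e i = n := by simp [he, Fin.sum_univ_four]
  have heM : ∀ M : {M : Multiset (Fin 4 → ℕ) //
      Multiset.card M = d + 1 ∧ (∀ α ∈ M, ∑ i, α i = n) ∧ M.sum = ν + e}, e ∈ M.1 := by
    intro M
    obtain ⟨hcard, hmem, hsum⟩ := M.2
    by_contra hne
    have hall : ∀ α ∈ M.1, α 1 + α 2 + α 3 ≠ 0 := by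
      intro α hα h0
      have hαe := eq_head4_of_tail_eq_zero (hmem α hα) h0
      rw [hαe, ← he] at hα
      exact hne hα
    have hfilt : M.1.filter (fun α => α 1 + α 2 + α 3 ≠ 0) = M.1 := Multiset.filter_eq_self.mpr hall
    have h1 := card_filter_tail4_le M.1
    rw [hfilt, hcard, hsum] at h1
    simp [he] at h1
    omega
  unfold dipMonomialCount
  refine Nat.card_congr
    { toFun := fun M => ⟨M.1.erase e, ?_⟩
      invFun := fun M => ⟨e ::ₘ M.1, ?_⟩
      left_inv := ?_
      right_inv := ?_ }
  · obtain ⟨hcard, hmem, hsum⟩ := M.2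
    refine ⟨?_, fun α hα => hmem α (Multiset.mem_of_mem_erase hα), ?_⟩
    · rw [Multiset.card_erase_of_mem (heM M), hcard]
      rfl
    · have h2 : (e ::ₘ M.1.erase e).sum = M.1.sum := by rw [Multiset.cons_erase (heM M)]
      rw [Multiset.sum_cons, hsum, add_comm] at h2
      exact add_right_cancel h2
  · obtain ⟨hcard, hmem, hsum⟩ := M.2
    refine ⟨by rw [Multiset.card_cons, hcard], fun α hα => ?_, by rw [Multiset.sum_cons, hsum, add_comm]⟩
    rcases Multiset.mem_cons.mp hα with rfl | hα
    · exact hesum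
    · exact hmem α hα
  · intro M
    apply Subtype.ext
    exact Multiset.cons_erase (heM M)
  · intro M
    apply Subtype.ext
    exact Multiset.erase_cons_head e M.1

/-- **`n`-stabilisation, four rows**: for `y + z + w ≤ n` (`ν = (x,y,z,w)`), raising every first
coordinate by one is a bijection from the multisets counted by `c_ν(d,n)` onto those counted by
`c_{ν+(d,0,0,0)}(d,n+1)`. [cite: DorflerIkenmeyerPanova2020, eq. (4.3) (arXiv p. 9)] -/
theorem dipMonomialCount_succ_n_four (n d : ℕ) (ν : Fin 4 → ℕ) (hν : ν 1 + ν 2 + ν 3 ≤ n) :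
    dipMonomialCount (ν + ![d, 0, 0, 0]) d (n + 1) = dipMonomialCount ν d n := by
  classical
  set u : Fin 4 → ℕ := ![1, 0, 0, 0] with hu
  have husum : ∑ i, u i = 1 := by simp [hu, Fin.sum_univ_four]
  have hsmul : ∀ m : ℕ, m • u = ![m, 0, 0, 0] := fun m => by
    funext i; fin_cases i <;> simp [hu]
  have hge : ∀ (M : Multiset (Fin 4 → ℕ)), (∀ α ∈ M, ∑ i, α i = n + 1) → M.sum = ν + ![d, 0, 0, 0] →
      ∀ α ∈ M, u ≤ α := by
    intro M hmem hsum α hα i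
    fin_cases i
    · have h1 := apply_le_sum_apply4 hα 1
      have h2 := apply_le_sum_apply4 hα 2
      have h3 := apply_le_sum_apply4 hα 3
      have hs := hmem α hα
      rw [Fin.sum_univ_four] at hs
      rw [hsum] at h1 h2 h3
      simp at h1 h2 h3
      show 1 ≤ α 0
      omega
    · simp [hu]
    · simp [hu]
    · simp [hu]
  unfold dipMonomialCount
  refine Nat.card_congr
    { toFun := fun M => ⟨M.1.map (fun α => α - u), ?_⟩
      invFun := fun M => ⟨M.1.map (fun α => α + u), ?_⟩
      left_inv := ?_
      right_inv := ?_ }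
  · obtain ⟨hcard, hmem, hsum⟩ := M.2
    have hge' := hge M.1 hmem hsum
    refine ⟨by rw [Multiset.card_map, hcard], fun β hβ => ?_, ?_⟩
    · obtain ⟨α, hα, rfl⟩ := Multiset.mem_map.mp hβ
      have hs := hmem α hα
      have hle := hge' α hα
      have : ∑ i, (α - u) i + ∑ i, u i = ∑ i, α i := by
        rw [← Finset.sum_add_distrib]
        exact Finset.sum_congr rfl fun i _ => tsub_add_cancel_of_le (hle i)
      omega
    · have h1 : (M.1.map (fun α => α - u)).sum + Multiset.card M.1 • u = M.1.sum := by
        rw [← Multiset.sum_replicate, ← Multiset.map_const', ← Multiset.sum_map_add]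
        have hm : M.1.map (fun α => α - u + u) = M.1.map (fun α => α) :=
          Multiset.map_congr rfl fun α hα => tsub_add_cancel_of_le (hge' α hα)
        rw [hm, Multiset.map_id']
      rw [hcard, hsum, hsmul] at h1
      exact add_right_cancel h1
  · obtain ⟨hcard, hmem, hsum⟩ := M.2
    refine ⟨by rw [Multiset.card_map, hcard], fun β hβ => ?_, ?_⟩
    · obtain ⟨α, hα, rfl⟩ := Multiset.mem_map.mp hβ
      have hs := hmem α hα
      simp only [Pi.add_apply, Finset.sum_add_distrib, hs, husum]
    · rw [Multiset.sum_map_add, Multiset.map_id', Multiset.map_const', Multiset.sum_replicate, hsum, hcard,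
        hsmul]
  · intro M
    apply Subtype.ext
    simp only [Multiset.map_map, Function.comp_def]
    obtain ⟨hcard, hmem, hsum⟩ := M.2
    conv_rhs => rw [← Multiset.map_id M.1]
    refine Multiset.map_congr rfl fun α hα => ?_
    exact tsub_add_cancel_of_le (hge M.1 hmem hsum α hα)
  · intro M
    apply Subtype.ext
    simp only [Multiset.map_map, Function.comp_def, add_tsub_cancel_right, Multiset.map_id']

end Stabilisation4

end Literature.Computability.AlgebraicComplexity
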